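import Mathlib
import HarnessLib
import Literature.MathematicalPhysics.QuantumLattice.KohnLuttinger
import Literature.MathematicalPhysics.QuantumLattice.KohnLuttingerLindhardMeasurable
import Summits.HubbardSuperconductivity.HubbardSuperconductivity.Theorems.ChiralWindowCwKLChiralWindowMuWindow
import Summits.HubbardSuperconductivity.HubbardSuperconductivity.Theorems.KLProgrammeMuOfDopingWindowConvex
import Summits.HubbardSuperconductivity.HubbardSuperconductivity.Theorems.KLProgrammeFermiSeaConvex
import Summits.HubbardSuperconductivity.HubbardSuperconductivity.Theorems.WeakCouplingBCSKlCertFermiSeaPolygonSound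

/-!
# Route `WeakCouplingBCS` / `KLProgramme` — SOUNDNESS (part II) of the CIRCUMSCRIBED polygon certificates `FSPoly.OCert`
# (`WeakCouplingBCSDefsFermiSeaPolygonCert.lean`; companion of `WeakCouplingBCSKlCertFermiSeaPolygonSound.lean`)

`FSPoly.OCert.filling_le` — an accepted circumscribed certificate at level `c > 0` gives `n(-2c) ≤ area / (2π²)` for the
free band `ε₀ = squareDispersion 1 0`.  For a certified piece with left end `x_i ≥ 0`, the supporting half-plane of the
convex sea `R_c` at the boundary point `(x_i, Y_i)`, `Y_i = arccos (c - cos x_i)` (`FSPoly.fermiSeaCoord_halfplane`), applied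
to the reflected point `(|q.1|, |q.2|) ∈ R_c`, gives `|q.2| < Y_i - (sin x_i / sin Y_i)(|q.1| - x_i) ≤ yp_i + d_i (|q.1| - x_i)`
whenever `|q.1| ≥ x_i` (`OPiece.abs_lt_of_ok`: the checker certifies `Y_i ≤ yp_i` and `-sin x_i / sin Y_i ≤ d_i ≤ 0` from
the stored cosine enclosures `cl ≤ cos x_i ≤ cu`, `cos yp_i ≤ cuy`, re-certified against the Taylor polynomials).  Hence
the part of the sea over `x_i < |q.1| ≤ x_{i+1}` lies in the two trapezoids of the piece (`OPiece.mem_trap_pos/neg`), the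
pieces cover `|q.1| < arccos (c - 1) ≤ xN` (`OCert.union_spec`, induction on the piece list, volumes by `volume_trapezoid`
and `measure_union_le`), and the occupied region of the Brillouin zone maps into `R_c` (`cos k₀ + cos k₁ > c > 0 ⇒
|k₀| + |k₁| < π`, `abs_add_abs_lt_pi_of_cos_add_cos_pos`) and is transported by `measurePreserving_momentum_prod`
(`OCert.volume_le`).  Folklore; no definitions.
-/

noncomputable section

-- the tree's namespace `Summit.<Summit>.<Problem>.Theorems` repeats the summit name by design (D-0017)
set_option linter.dupNamespace false

namespace Summit.HubbardSuperconductivity.HubbardSuperconductivity.Theorems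

namespace FSPoly

open MeasureTheory Set Literature.MathematicalPhysics.QuantumLattice

/-! ### Circumscribed tangent pieces: soundness -/

/-- **The tangent bound of a certified piece.** If `p.ok c x'` holds then every `q ∈ R_c` with `p.x ≤ |q.1|` has
`|q.2| < yp + d (|q.1| - p.x)`. [folklore] -/
theorem OPiece.abs_lt_of_ok {c x' : ℚ} {p : OPiece} (hc : 0 < c) (h : p.ok c x' = true) {q : ℝ × ℝ}
    (hq : q ∈ fermiSeaCoord (c : ℝ)) (hx : (p.x : ℝ) ≤ |q.1|) :
    |q.2| < (p.yp : ℝ) + (p.d : ℝ) * (|q.1| - p.x) := by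
  simp only [OPiece.ok, Bool.and_eq_true, decide_eq_true_eq] at h
  obtain ⟨⟨⟨⟨⟨⟨⟨⟨⟨⟨⟨⟨⟨hcl, hcu⟩, hcuy⟩, hx0⟩, -⟩, hxpi⟩, hc1⟩, hc2⟩, hyp0⟩, hyppi⟩, hcos⟩, hd0⟩, hslope⟩, -⟩ := h
  -- real versions of the rational facts
  have hx0' : (0 : ℝ) ≤ (p.x : ℝ) := by exact_mod_cast hx0
  have hpiQ : ((piLoQ : ℚ) : ℝ) < Real.pi := by rw [piLoQ]; push_cast; linarith [Real.pi_gt_d6]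
  have hxpi' : (p.x : ℝ) ≤ Real.pi := by
    have : ((p.x : ℚ) : ℝ) ≤ ((piLoQ : ℚ) : ℝ) := by exact_mod_cast hxpi
    linarith
  have hyp0' : (0 : ℝ) ≤ (p.yp : ℝ) := by exact_mod_cast hyp0
  have hyppi' : (p.yp : ℝ) ≤ Real.pi := by
    have : ((p.yp : ℚ) : ℝ) ≤ ((piLoQ : ℚ) : ℝ) := by exact_mod_cast hyppi
    linarith
  have hd0' : (p.d : ℝ) ≤ 0 := by exact_mod_cast hd0
  set t : ℝ := (c : ℝ) - Real.cos (p.x : ℝ) with ht_def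
  have hLo : ((p.cl : ℚ) : ℝ) ≤ Real.cos (p.x : ℝ) := by
    have : ((p.cl : ℚ) : ℝ) ≤ ((cosLoQ p.x : ℚ) : ℝ) := by exact_mod_cast hcl
    exact this.trans (cosLoQ_le_cos p.x)
  have hUp : Real.cos (p.x : ℝ) ≤ ((p.cu : ℚ) : ℝ) := by
    have : ((cosUpQ p.x : ℚ) : ℝ) ≤ ((p.cu : ℚ) : ℝ) := by exact_mod_cast hcu
    exact (cos_le_cosUpQ p.x).trans this
  have hUpy : Real.cos (p.yp : ℝ) ≤ ((p.cuy : ℚ) : ℝ) := by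
    have : ((cosUpQ p.yp : ℚ) : ℝ) ≤ ((p.cuy : ℚ) : ℝ) := by exact_mod_cast hcuy
    exact (cos_le_cosUpQ p.yp).trans this
  have ht1 : t < 1 := by
    have : ((c - p.cl : ℚ) : ℝ) < 1 := by exact_mod_cast hc1
    push_cast at this; rw [ht_def]; linarith
  have ht2 : -1 < t := by
    have : (-1 : ℝ) < ((c - p.cu : ℚ) : ℝ) := by exact_mod_cast hc2
    push_cast at this; rw [ht_def]; linarith
  -- the boundary point `(p.x, Y)`
  set Y : ℝ := Real.arccos t with hY_def
  have hcosY : Real.cos Y = t := Real.cos_arccos ht2.le ht1.le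
  have hsinY : Real.sin Y = Real.sqrt (1 - t ^ 2) := Real.sin_arccos t
  have hsinY_pos : 0 < Real.sin Y := by
    rw [hsinY]; exact Real.sqrt_pos.2 (by nlinarith)
  have hY0 : 0 ≤ Y := Real.arccos_nonneg t
  have hYpi : Y ≤ Real.pi := Real.arccos_le_pi t
  have hPc : Real.cos (p.x : ℝ) + Real.cos Y = c := by rw [hcosY, ht_def]; ring
  have hcpos : (0 : ℝ) < (c : ℝ) := by exact_mod_cast hc
  have hdiam : |(p.x : ℝ)| + |Y| < Real.pi :=
    abs_add_abs_lt_pi_of_cos_add_cos_pos (by rw [abs_of_nonneg hx0']; exact hxpi')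
      (by rw [abs_of_nonneg hY0]; exact hYpi) (by rw [hPc]; exact hcpos)
  -- the half-plane inequality at the reflected point `(|q.1|, |q.2|)`
  have hhp := fermiSeaCoord_halfplane hPc hdiam (abs_mem_fermiSeaCoord hq)
  simp only at hhp
  have hsinx : 0 ≤ Real.sin (p.x : ℝ) := Real.sin_nonneg_of_nonneg_of_le_pi hx0' hxpi'
  -- (a) `Y ≤ yp`
  have hYle : Y ≤ (p.yp : ℝ) := by
    have h1 : Real.cos (p.yp : ℝ) ≤ t := by
      have : ((p.cuy : ℚ) : ℝ) ≤ ((c - p.cu : ℚ) : ℝ) := by exact_mod_cast hcos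
      push_cast at this
      rw [ht_def]; linarith
    calc Y = Real.arccos t := rfl
      _ ≤ Real.arccos (Real.cos (p.yp : ℝ)) := Real.arccos_le_arccos h1
      _ = (p.yp : ℝ) := Real.arccos_cos hyp0' hyppi'
  -- (b) `-sin x / sin Y ≤ d`, via squares
  have hslope' : -(p.d : ℝ) * Real.sin Y ≤ Real.sin (p.x : ℝ) := by
    have hsq1 : ((p.mlo c : ℚ) : ℝ) ≤ t ^ 2 := by
      have hr : ((max 0 (max (p.cl - c) (c - p.cu)) : ℚ) : ℝ) ≤ |t| := by
        push_cast
        refine max_le (abs_nonneg _) (max_le ?_ ?_)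
        · rw [ht_def]; have := neg_abs_le ((c : ℝ) - Real.cos (p.x : ℝ)); linarith
        · rw [ht_def]; have := le_abs_self ((c : ℝ) - Real.cos (p.x : ℝ)); linarith
      have hr0 : (0 : ℝ) ≤ ((max 0 (max (p.cl - c) (c - p.cu)) : ℚ) : ℝ) := by
        push_cast; exact le_max_left _ _
      rw [OPiece.mlo]; push_cast
      have := pow_le_pow_left₀ hr0 hr 2
      rw [sq_abs] at this
      push_cast at this
      exact this
    have hsq2 : ((p.s2lo : ℚ) : ℝ) ≤ Real.sin (p.x : ℝ) ^ 2 := by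
      rw [OPiece.s2lo, Real.sin_sq]; push_cast
      have hcsq : Real.cos (p.x : ℝ) ^ 2 ≤ max (((p.cu : ℚ) : ℝ) ^ 2) (((p.cl : ℚ) : ℝ) ^ 2) := by
        rcases le_or_gt 0 (Real.cos (p.x : ℝ)) with h0 | h0
        · exact le_trans (pow_le_pow_left₀ h0 hUp 2) (le_max_left _ _)
        · refine le_trans ?_ (le_max_right _ _)
          have : -Real.cos (p.x : ℝ) ≤ -((p.cl : ℚ) : ℝ) := by linarith
          have h' := pow_le_pow_left₀ (by linarith) this 2
          simpa only [neg_sq] using h'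
      linarith
    have hslope_r : (p.d : ℝ) ^ 2 * (1 - ((p.mlo c : ℚ) : ℝ)) ≤ ((p.s2lo : ℚ) : ℝ) := by
      have : ((p.d ^ 2 * (1 - p.mlo c) : ℚ) : ℝ) ≤ ((p.s2lo : ℚ) : ℝ) := by exact_mod_cast hslope
      push_cast at this; exact this
    have hkey : (-(p.d : ℝ) * Real.sin Y) ^ 2 ≤ Real.sin (p.x : ℝ) ^ 2 := by
      have hS : Real.sin Y ^ 2 = 1 - t ^ 2 := by
        rw [hsinY, Real.sq_sqrt (by nlinarith)]
      calc (-(p.d : ℝ) * Real.sin Y) ^ 2 = (p.d : ℝ) ^ 2 * (1 - t ^ 2) := by rw [mul_pow, neg_sq, hS]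
        _ ≤ (p.d : ℝ) ^ 2 * (1 - ((p.mlo c : ℚ) : ℝ)) :=
            mul_le_mul_of_nonneg_left (by linarith) (sq_nonneg _)
        _ ≤ ((p.s2lo : ℚ) : ℝ) := hslope_r
        _ ≤ Real.sin (p.x : ℝ) ^ 2 := hsq2
    exact (pow_le_pow_iff_left₀ (mul_nonneg (by linarith) hsinY_pos.le) hsinx two_ne_zero).1 hkey
  -- combine
  have hq1 : 0 ≤ |q.1| - (p.x : ℝ) := by linarith
  have hmain : Real.sin Y * (|q.2| - Y) < -Real.sin (p.x : ℝ) * (|q.1| - (p.x : ℝ)) := by linarith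
  have hmain' : |q.2| - Y < (p.d : ℝ) * (|q.1| - (p.x : ℝ)) := by
    by_contra hcon
    push Not at hcon
    have := mul_le_mul_of_nonneg_left hcon hsinY_pos.le
    nlinarith [mul_le_mul_of_nonneg_right hslope' hq1]
  linarith

/-- Membership in a symmetric trapezoid, unfolded. [folklore] -/
theorem mem_trap_iff {x₀ x₁ y₀ y₁ : ℝ} {q : ℝ × ℝ} :
    q ∈ trap x₀ x₁ y₀ y₁ ↔ (x₀ < q.1 ∧ q.1 ≤ x₁) ∧ |q.2| < y₀ + (y₁ - y₀) / (x₁ - x₀) * (q.1 - x₀) := by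
  simp only [trap, regionBetween, mem_setOf_eq, mem_Ioc, mem_Ioo, abs_lt]

/-- The left end of a certified piece is nonnegative. [folklore] -/
theorem OPiece.x_nonneg_of_ok {c x' : ℚ} {p : OPiece} (h : p.ok c x' = true) : (0 : ℝ) ≤ (p.x : ℝ) := by
  simp only [OPiece.ok, Bool.and_eq_true, decide_eq_true_eq] at h
  obtain ⟨⟨⟨⟨⟨⟨⟨⟨⟨⟨⟨⟨⟨-, -⟩, -⟩, hx0⟩, -⟩, -⟩, -⟩, -⟩, -⟩, -⟩, -⟩, -⟩, -⟩, -⟩ := h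
  exact_mod_cast hx0

/-- The slope of the top edge of the trapezoids of a piece is `d`. [folklore] -/
theorem OPiece.slope_eq {x' : ℚ} (p : OPiece) (hxx' : (p.x : ℝ) < (x' : ℝ)) :
    ((((p.yp + p.d * (x' - p.x) : ℚ) : ℝ)) - (p.yp : ℝ)) / ((x' : ℝ) - (p.x : ℝ)) = (p.d : ℝ) := by
  have hne : (x' : ℝ) - (p.x : ℝ) ≠ 0 := ne_of_gt (sub_pos.2 hxx')
  rw [div_eq_iff hne]
  push_cast
  ring

/-- Membership in the right trapezoid of a certified piece. [folklore] -/
theorem OPiece.mem_trap_pos {c x' : ℚ} {p : OPiece} (hc : 0 < c) (h : p.ok c x' = true) {q : ℝ × ℝ}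
    (hq : q ∈ fermiSeaCoord (c : ℝ)) (h1 : (p.x : ℝ) < q.1) (h2 : q.1 ≤ (x' : ℝ)) : q ∈ p.traps x' := by
  have hx0 := OPiece.x_nonneg_of_ok h
  have hq1pos : 0 < q.1 := by linarith
  have hlt := OPiece.abs_lt_of_ok hc h hq (by rw [abs_of_pos hq1pos]; exact h1.le)
  rw [abs_of_pos hq1pos] at hlt
  have hxx' : (p.x : ℝ) < (x' : ℝ) := lt_of_lt_of_le h1 h2
  left
  rw [mem_trap_iff, p.slope_eq hxx']
  exact ⟨⟨h1, h2⟩, hlt⟩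

/-- Membership in the left (mirrored) trapezoid of a certified piece. [folklore] -/
theorem OPiece.mem_trap_neg {c x' : ℚ} {p : OPiece} (hc : 0 < c) (h : p.ok c x' = true) {q : ℝ × ℝ}
    (hq : q ∈ fermiSeaCoord (c : ℝ)) (h0 : q.1 ≤ 0) (h1 : (p.x : ℝ) ≤ -q.1) (h2 : -q.1 < (x' : ℝ)) :
    q ∈ p.traps x' := by
  have hlt := OPiece.abs_lt_of_ok hc h hq (by rw [abs_of_nonpos h0]; exact h1)
  rw [abs_of_nonpos h0] at hlt
  have hxx' : (p.x : ℝ) < (x' : ℝ) := lt_of_le_of_lt h1 h2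
  right
  rw [mem_trap_iff]
  refine ⟨⟨by linarith, by linarith⟩, ?_⟩
  have hne : -(p.x : ℝ) - -(x' : ℝ) ≠ 0 := by
    have : 0 < -(p.x : ℝ) - -(x' : ℝ) := by linarith
    exact ne_of_gt this
  have hs : ((p.yp : ℝ) - (((p.yp + p.d * (x' - p.x) : ℚ) : ℝ))) / (-(p.x : ℝ) - -(x' : ℝ)) = -(p.d : ℝ) := by
    rw [div_eq_iff hne]
    push_cast
    ring
  rw [hs]
  push_cast
  nlinarith

/-- Measurability and volume of the two trapezoids of a certified piece: at most `2 h (2 yp + d h)`. [folklore] -/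
theorem OPiece.volume_traps_le {c x' : ℚ} {p : OPiece} (h : p.ok c x' = true) :
    MeasurableSet (p.traps x') ∧
      volume (p.traps x') ≤ ENNReal.ofReal (((2 * ((x' - p.x) * (2 * p.yp + p.d * (x' - p.x))) : ℚ) : ℝ)) ∧
      (0 : ℚ) ≤ 2 * ((x' - p.x) * (2 * p.yp + p.d * (x' - p.x))) := by
  simp only [OPiece.ok, Bool.and_eq_true, decide_eq_true_eq] at h
  obtain ⟨⟨⟨⟨⟨⟨⟨⟨⟨⟨⟨⟨⟨-, -⟩, -⟩, -⟩, hxx'⟩, -⟩, -⟩, -⟩, hyp0⟩, -⟩, -⟩, -⟩, -⟩, htop⟩ := h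
  have hxx'r : (p.x : ℝ) < (x' : ℝ) := by exact_mod_cast hxx'
  have hyp0r : (0 : ℝ) ≤ (p.yp : ℝ) := by exact_mod_cast hyp0
  have htopr : (0 : ℝ) ≤ (((p.yp + p.d * (x' - p.x)) : ℚ) : ℝ) := by exact_mod_cast htop
  have hV1 : volume (trap (p.x : ℝ) (x' : ℝ) (p.yp : ℝ) ((p.yp + p.d * (x' - p.x) : ℚ) : ℝ)) =
      ENNReal.ofReal (((x' : ℝ) - p.x) * ((p.yp : ℝ) + (((p.yp + p.d * (x' - p.x)) : ℚ) : ℝ))) :=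
    volume_trapezoid hxx'r hyp0r htopr
  have hV2 : volume (trap (-(x' : ℝ)) (-(p.x : ℝ)) ((p.yp + p.d * (x' - p.x) : ℚ) : ℝ) (p.yp : ℝ)) =
      ENNReal.ofReal ((-(p.x : ℝ) - -(x' : ℝ)) * ((((p.yp + p.d * (x' - p.x)) : ℚ) : ℝ) + (p.yp : ℝ))) :=
    volume_trapezoid (show -(x' : ℝ) < -(p.x : ℝ) by linarith) htopr hyp0r
  refine ⟨(measurableSet_trapezoid _ _ _ _).union (measurableSet_trapezoid _ _ _ _), ?_, ?_⟩
  · refine (measure_union_le _ _).trans ?_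
    show volume (trap (p.x : ℝ) (x' : ℝ) (p.yp : ℝ) ((p.yp + p.d * (x' - p.x) : ℚ) : ℝ)) +
        volume (trap (-(x' : ℝ)) (-(p.x : ℝ)) ((p.yp + p.d * (x' - p.x) : ℚ) : ℝ) (p.yp : ℝ)) ≤ _
    rw [hV1, hV2, ← ENNReal.ofReal_add (mul_nonneg (by linarith) (by linarith))
      (mul_nonneg (by linarith) (by linarith))]
    refine ENNReal.ofReal_le_ofReal (le_of_eq ?_)
    push_cast
    ring
  · have h1 : (0 : ℚ) ≤ p.yp + p.d * (x' - p.x) := htop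
    nlinarith

/-- **Soundness of the circumscribed chain** (induction on the piece list): the union from `p` on is measurable,
has volume at most `areaList ≥ 0`, and contains every `q ∈ R_c` whose `|q.1|` lies in its `x`-range. [folklore] -/
theorem OCert.union_spec {c xN : ℚ} (hc : 0 < c) :
    ∀ (rest : List OPiece) (p : OPiece), OCert.chainOK c xN p rest = true →
      MeasurableSet (OCert.union xN p rest) ∧
        volume (OCert.union xN p rest) ≤ ENNReal.ofReal ((OCert.areaList xN p rest : ℚ) : ℝ) ∧
        (0 : ℚ) ≤ OCert.areaList xN p rest ∧
        ∀ q ∈ fermiSeaCoord (c : ℝ),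
          ((0 < q.1 ∧ (p.x : ℝ) < q.1 ∧ q.1 < (xN : ℝ)) ∨ (q.1 ≤ 0 ∧ (p.x : ℝ) ≤ -q.1 ∧ -q.1 < (xN : ℝ))) →
            q ∈ OCert.union xN p rest := by
  intro rest
  induction rest with
  | nil =>
    intro p h
    simp only [OCert.chainOK] at h
    obtain ⟨hM, hV, hA⟩ := OPiece.volume_traps_le h
    refine ⟨hM, hV, hA, ?_⟩
    intro q hq hcase
    show q ∈ p.traps xN
    rcases hcase with ⟨h0, h1, h2⟩ | ⟨h0, h1, h2⟩
    · exact OPiece.mem_trap_pos hc h hq h1 h2.le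
    · exact OPiece.mem_trap_neg hc h hq h0 h1 h2
  | cons p' rest ih =>
    intro p h
    simp only [OCert.chainOK, Bool.and_eq_true] at h
    obtain ⟨hp, hrest⟩ := h
    obtain ⟨hM', hV', hA', hC'⟩ := ih p' hrest
    obtain ⟨hM, hV, hA⟩ := OPiece.volume_traps_le hp
    refine ⟨hM.union hM', ?_, ?_, ?_⟩
    · refine (measure_union_le _ _).trans ?_
      show volume (p.traps p'.x) + volume (OCert.union xN p' rest) ≤
        ENNReal.ofReal (((2 * ((p'.x - p.x) * (2 * p.yp + p.d * (p'.x - p.x))) + OCert.areaList xN p' rest : ℚ) : ℝ))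
      rw [Rat.cast_add, ENNReal.ofReal_add (by exact_mod_cast hA) (by exact_mod_cast hA')]
      exact add_le_add hV hV'
    · show (0 : ℚ) ≤ 2 * ((p'.x - p.x) * (2 * p.yp + p.d * (p'.x - p.x))) + OCert.areaList xN p' rest
      linarith
    · intro q hq hcase
      show q ∈ p.traps p'.x ∪ OCert.union xN p' rest
      rcases hcase with ⟨h0, h1, h2⟩ | ⟨h0, h1, h2⟩
      · rcases le_or_gt q.1 (p'.x : ℝ) with h3 | h3
        · exact Or.inl (OPiece.mem_trap_pos hc hp hq h1 h3)
        · exact Or.inr (hC' q hq (Or.inl ⟨h0, h3, h2⟩))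
      · rcases lt_or_ge (-q.1) (p'.x : ℝ) with h3 | h3
        · exact Or.inl (OPiece.mem_trap_neg hc hp hq h0 h1 h3)
        · exact Or.inr (hC' q hq (Or.inr ⟨h0, h3, h2⟩))

/-- **An accepted circumscribed certificate bounds the occupied volume from above by its area.** [folklore] -/
theorem OCert.volume_le (C : OCert) (h : C.check = true) :
    volume ({k : Momentum | squareDispersion 1 0 k < -2 * (C.c : ℝ)} ∩ brillouinZone) ≤
      ENNReal.ofReal ((C.area : ℚ) : ℝ) := by
  obtain ⟨c, ps, xN⟩ := C
  simp only [OCert.check, Bool.and_eq_true, decide_eq_true_eq] at h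
  obtain ⟨⟨⟨⟨hc, hxN0⟩, hxNpi⟩, hxNcos⟩, hps⟩ := h
  cases ps with
  | nil => simp at hps
  | cons p rest =>
    simp only [Bool.and_eq_true, decide_eq_true_eq] at hps
    obtain ⟨hpx, hchain⟩ := hps
    obtain ⟨hM, hV, -, hC⟩ := OCert.union_spec hc rest p hchain
    show volume ({k : Momentum | squareDispersion 1 0 k < -2 * (c : ℝ)} ∩ brillouinZone) ≤
      ENNReal.ofReal (((OCert.areaList xN p rest : ℚ) : ℝ))
    have hcr : (0 : ℝ) < (c : ℝ) := by exact_mod_cast hc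
    have hxN0r : (0 : ℝ) ≤ (xN : ℝ) := by exact_mod_cast hxN0
    have hxNpir : (xN : ℝ) ≤ Real.pi := by
      have : ((xN : ℚ) : ℝ) ≤ ((piLoQ : ℚ) : ℝ) := by exact_mod_cast hxNpi
      have hpiQ : ((piLoQ : ℚ) : ℝ) < Real.pi := by rw [piLoQ]; push_cast; linarith [Real.pi_gt_d6]
      linarith
    have hxNcosr : Real.cos (xN : ℝ) ≤ (c : ℝ) - 1 := by
      have : ((cosUpQ xN : ℚ) : ℝ) ≤ ((c - 1 : ℚ) : ℝ) := by exact_mod_cast hxNcos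
      push_cast at this
      linarith [cos_le_cosUpQ xN]
    -- the occupied region maps into the union
    have hsub : {k : Momentum | squareDispersion 1 0 k < -2 * (c : ℝ)} ∩ brillouinZone ⊆
        (fun k : Momentum => ((k 0, k 1) : ℝ × ℝ)) ⁻¹' OCert.union xN p rest := by
      intro k hk
      obtain ⟨hk1, hk2⟩ := hk
      simp only [mem_setOf_eq, squareDispersion] at hk1
      have hsum : (c : ℝ) < Real.cos (k 0) + Real.cos (k 1) := by linarith
      have hb0 := hk2 0
      have hb1 := hk2 1
      have ha0 : |k 0| ≤ Real.pi := abs_le.2 ⟨hb0.1, hb0.2.le⟩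
      have ha1 : |k 1| ≤ Real.pi := abs_le.2 ⟨hb1.1, hb1.2.le⟩
      have hq : ((k 0, k 1) : ℝ × ℝ) ∈ fermiSeaCoord (c : ℝ) :=
        mem_fermiSeaCoord' (abs_add_abs_lt_pi_of_cos_add_cos_pos ha0 ha1 (by linarith)) hsum
      -- `|k 0| < xN`
      have hlt : |k 0| < (xN : ℝ) := by
        by_contra hcon
        push Not at hcon
        have h1 : Real.cos |k 0| ≤ Real.cos (xN : ℝ) := Real.cos_le_cos_of_nonneg_of_le_pi hxN0r ha0 hcon
        rw [Real.cos_abs] at h1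
        linarith [Real.cos_le_one (k 1)]
      refine hC _ hq ?_
      rw [hpx]; push_cast
      rcases lt_or_ge 0 (k 0) with h0 | h0
      · exact Or.inl ⟨h0, h0, by rw [abs_of_pos h0] at hlt; exact hlt⟩
      · exact Or.inr ⟨h0, by linarith, by rw [abs_of_nonpos h0] at hlt; exact hlt⟩
    refine (measure_mono hsub).trans ?_
    rw [measurePreserving_momentum_prod.measure_preimage hM.nullMeasurableSet]
    exact hV

/-- **Certified upper filling bound**: an accepted circumscribed certificate at level `c` gives
`n(-2c) ≤ area / (2π²)`. [folklore] -/
theorem OCert.filling_le (C : OCert) (h : C.check = true) :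
    KohnLuttinger.filling (squareDispersion 1 0) (-2 * (C.c : ℝ)) ≤ ((C.area : ℚ) : ℝ) / (2 * Real.pi ^ 2) := by
  have hA : (0 : ℝ) ≤ ((C.area : ℚ) : ℝ) := by
    obtain ⟨c, ps, xN⟩ := C
    have h' := h
    simp only [OCert.check, Bool.and_eq_true, decide_eq_true_eq] at h'
    obtain ⟨⟨⟨⟨hc, -⟩, -⟩, -⟩, hps⟩ := h'
    cases ps with
    | nil => simp at hps
    | cons p rest =>
      simp only [Bool.and_eq_true, decide_eq_true_eq] at hps
      have := (OCert.union_spec hc rest p hps.2).2.2.1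
      show (0 : ℝ) ≤ (((OCert.areaList xN p rest : ℚ) : ℝ))
      exact_mod_cast this
  have h1 := C.volume_le h
  have h2 : (volume ({p : Momentum | squareDispersion 1 0 p < -2 * (C.c : ℝ)} ∩ brillouinZone)).toReal ≤
      ((C.area : ℚ) : ℝ) := ENNReal.toReal_le_of_le_ofReal hA h1
  rw [kl_mu_filling_eq]
  have hpi : 0 < Real.pi := Real.pi_pos
  rw [div_le_div_iff₀ (by positivity) (by positivity)]
  nlinarith

end FSPoly

end Summit.HubbardSuperconductivity.HubbardSuperconductivity.Theorems

end
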